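/- Copyright: the b2b-balaban cell (near-miss cell 7), T⁴-continuum fan-out; row NE7b CRUX team (2), seat
t4-ne7b-formalise-leaf-03 (gen 27) — custodian's L5 of the OWNER's RULING R-OWNER-48-1 «THE GUARDED CUT» (journal l.32451,
IR-48-1′; AMENDMENT W-ne7bp1-g48-1 l.32563): the guarded twin of the (α) assembly (FILE 2 `HistoryRealiseCellsRunAssemblyWTVS`,
p281050) — the witness and the headline corollary on an INHABITABLE record.  Released under the licence of the surrounding project. -/
import Summits.QuantumFields.BalabanUV.T4Continuum.Support.HistoryRealiseCellsRunAssemblyWTVSDataL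
import Summits.QuantumFields.BalabanUV.T4Continuum.Support.HistoryRealiseCellsRunHeadlineT3bPWTVSL

/-!
# THE (α) ASSEMBLY, GUARDED: part 2 — THE L-WITNESS `CountRoadWitnessT3bWTVSL` INHABITED FROM M2 BRICK B's READING OF
# (1.72), AND THE HEADLINE OVER THE REPAIRED END v3.1 (the cut's L5)
(re-open object (α) of row NE7b; RULING R-OWNER-48-1 «THE GUARDED CUT», IR-48-1′; lineage `t4-ne7b-formalise-leaf-03` gen 27,
custodian of the S12-W crew)

Summits-side support leaf of the T⁴-continuum cell (rung (B)+1 on a FINITE torus only; NOT infinite volume, NOT the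
mass gap, NOT the Clay statement; NOT a proof of the spine estimate NE7b — the cell's OWN estimate, NOT PRINTED, NOT
PROVED).  [folklore] composition BY NAME, field by field, of the S12-W crew's and the owner's modules into the GUARDED
witness shape `HistoryRealiseCellsRunApexT3bWTVSL.CountRoadWitnessT3bWTVSL` (owner, L3a); one `def` (§3's record embedding
`HistReadData.toL`, data-level), no `[cite:]` tag, nothing printed asserted, no `Prop` fact minted, zero `sorry`.  THE
ASSEMBLY PROVES NOTHING OF BAŁABAN's: it makes the WALL's R∕S-list LITERALLY the field list of ONE record `HistReadDataL` (L4)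
feeding ONE kernel theorem — and, unlike FILE 2's
`HistReadData` (whose unguarded display `hDJ` is unsatisfiable as typed, R-OWNER-47-3 ∕ 48-1 (n1)), that record carries no
field known to be uninhabitable: the two S1c-opt reading clauses are no longer displayed but PROVED of the reading.

WHAT.  §1 **`nonempty_countRoadWitnessT3bWTVSL_of_histReadingL`** (R-OWNER-48-1 L5's decl : type): from `HistReadDataL` ALONE,
`Nonempty (CountRoadWitnessT3bWTVSL D C O θᵥ rr d n hn g₀ os (HIndex.Idx I) (ℕ × Lab d) (Lab d))` — FILE 2's term
`nonempty_countRoadWitnessT3bWTVS_of_histReading` VERBATIM (SPEC IR-46-2 §3's table: `T := termSet I`, `A := weight μ RA t`,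
`reprA` := `H2A` ∘ M2-A `integral_eq_sum_weight`, `A′ := weightB νB RB trunc`, `reprB` := `H2B` ∘ M2-C `reprB_of_holds_trunc`,
`realised` := JunctionV `realisedDomainsRW_of_familyV` transported along (c1), root-cell injectivity `cellOfR_injOn_W`,
`priceM(′)` := `priceM_of_reading`, `upM` := `upM_of_reading′`, `deadM_nonneg` := `deadM_nonneg_of_reading`, `resumM` :=
`resumM_of_reading` ∘ (ρ), `FM_nonneg` := `FM_nonneg_of_reading`, `dead := deadOf`, `nup := nupOf`, `nup_bd` := `nupOf_le`,
run B v0.5 := M2-C `upM'_of_trunc` ∕ `deadM'_nonneg_of_trunc` ∕ `resumM'_of_trunc` on the «TRUNC» displays; NE7c, NE7,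
(γ)∕sites pass through) EXCEPT THE THREE PLUGS of the cut: `realised`'s box input := `RunInputM.inBoxOK_of_regionsInBox (hN …)
(hreg …)`; **`disjointJoins := ℛ.inputOf.disjointJoinsL_pedV (termSet I) K₀ hN hRm hRmS hRm2 hD hL0'`** (IR-47-1′ PART 3,
p281208: the GUARDED display is a THEOREM on pass V from the input displays only); **`boxedBirths := ℛ.inputOf.boxedBirths_pedV
… hreg`** transported along (c1)'s `ℛ.L = F.L`, `ℛ.s = runProfile F.L ℛ.R` exactly like `realised` (a THEOREM modulo the input
display `RegionsInBox`).  `[DecidableEq (HIndex.Idx I)]` is BOUND by the theorem ((c7)) and discharged only in §2: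
**`continuumYM4Torus_of_histReadingL_fsc`** = the GUARDED P-road headline `HistoryRealiseCellsRunHeadlineT3bPWTVSL.
continuumYM4Torus_of_countRoadT3bPWTVSL_fsc` (leaf-04, L3b; END v3.1: `0 < θ`, NO demand `hθJ` on print's constants — the
statement leaf-04 staged as `_fscP` and the owner SUBSUMED into L5) with its `hData` supplied, for all small couplings and every
loop string, by SOME reading `HistReadDataL …` (skeletons, spaces, measures existentially) — `ForSmallCouplings.mono` ∘ §1.
§3 (builder's addition, the record-level twin of the owner's `CountRoadWitnessT3bWTVS.toL`): **`HistReadData.toL`** — a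
FILE-1 record plus the input display `hreg` IS an L4 record (fields copied, `hDJ`∕`hBB`∕`hbox` dropped) —, `toL_data`, and the
corollary `nonempty_countRoadWitnessT3bWTVSL_of_histReading` (§1 ∘ `toL`), so FILE 1's toy inhabitants transport.
Append-only: FILE 2's two theorems (over `HistReadData`, END v3′ with `hθJ`) stay, UNCHANGED BY NAME, SUPERSEDED FOR
INHABITATION by this file.

HONEST SCOPE.  The R-list of (α) after this theorem = `HistReadDataL`'s displays (FILE 1's classes; `hreg` R, input side):
`holdsA`∕`intA`∕`H2A` and `holdsB`∕`intB`∕`H2B` ((1.72)-holds + H2, both runs), `HistRead` (THE identification), the pass-V input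
conditions incl. `RegionsInBox`, `isRj` + the flow's K-facts, volume calibrations + `huV`, `FactorRead`, `RoundingRoomF` (both
runs' letters), `FlowIneq29`, (ρ) `FibreMass` and (ρ′), `W∞`∕`BA∞`∕`m∞`, (γ)∕sites, run B's numerator readings keyed at run A's
keys «TRUNC»; S: `trunc` + `MapsTo` (NODE O), NE7c `shell`, NE7 `budget` + rates.  `DisjointJoinsL` is K on pass V and
`BoxedBirths` K modulo `RegionsInBox` — NOT displayed any more.  NE7b NOT proved; spine 0∕9.  HONEST DEPENDENCY (cell):
continuum YM on T⁴ ⇐ BetaPertH ∧ nine spine estimates (0/9 proved); BetaPertH ⇐ (D1) ∧ (D4) ∧ CAP+tail; G-an2-4 gates asym,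
D1 and NE2/3/4.  This file changes none of it.
-/

open Finset MeasureTheory
open Literature.MathematicalPhysics.QuantumFieldTheory.Balaban1983to89
open T4PersistenceDictionary T4PersistentHistoryCount T4BankedInduction T4PrintedShapeBanking
open T4WeightBudget T4GlobalDenominator T4LiveClassFibration T4LiveStructureGas T4LiveGasToTerms T4RecordPriceSeam
open T4PartnerMultiplicity T4IndicatorShell T4MatchingAssembly T4MatchingClosure T4MatchingClosureSocket T4Continuum
open T4StabilitySocket T4BranchingRecordsGas T4TaggedShapeBanking T4CanonicalMenus T4RenewalChains
open Summit.QuantumFields.BalabanUV.T4Continuum.PlacementBatch Summit.QuantumFields.BalabanUV.T4Continuum.PlacementSkeleton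
open Summit.QuantumFields.BalabanUV.T4Continuum.CountThresholdUniform Summit.QuantumFields.BalabanUV.T4Continuum.CountThresholdExit
open Summit.QuantumFields.BalabanUV.T4Continuum.CountSeamJunction Summit.QuantumFields.BalabanUV.T4Continuum.LateMergers
open Summit.QuantumFields.BalabanUV.T4Continuum.HistoryFlow Summit.QuantumFields.BalabanUV.T4Continuum.HistoryRegeneration
open Summit.QuantumFields.BalabanUV.T4Continuum.HistoryTables Summit.QuantumFields.BalabanUV.T4Continuum.HistoryAssemblyTrees
open Summit.QuantumFields.BalabanUV.T4Continuum.HistoryAssemblyTerms Summit.QuantumFields.BalabanUV.T4Continuum.HistoryAssemblyPedigree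
open Summit.QuantumFields.BalabanUV.T4Continuum.HistoryConstants Summit.QuantumFields.BalabanUV.T4Continuum.HistoryGen
open Literature.MathematicalPhysics.QuantumFieldTheory.Balaban1983to89.B13ScaleTransfer
open Summit.QuantumFields.BalabanUV.T4Continuum.ZoneSkeleton Summit.QuantumFields.BalabanUV.T4Continuum.HistorySocketTH
open Summit.QuantumFields.BalabanUV.T4Continuum.HistoryCaps Summit.QuantumFields.BalabanUV.T4Continuum.HistoryAssemblyPrice
open Summit.QuantumFields.BalabanUV.T4Continuum.HistoryBankingLE Summit.QuantumFields.BalabanUV.T4Continuum.HistoryExitLE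
open Summit.QuantumFields.BalabanUV.T4Continuum.HistoryAssemblyTreesLE Summit.QuantumFields.BalabanUV.T4Continuum.HistoryAssemblyTermsLE
open Summit.QuantumFields.BalabanUV.T4Continuum.HistoryRealise Summit.QuantumFields.BalabanUV.T4Continuum.HistoryAssemblyRealiseLE
open Summit.QuantumFields.BalabanUV.T4Continuum.HistoryAssemblyMult Summit.QuantumFields.BalabanUV.T4Continuum.HistoryAssemblyMultKey
open Summit.QuantumFields.BalabanUV.T4Continuum.HistoryAssemblyRealiseRun Summit.QuantumFields.BalabanUV.T4Continuum.HistoryAssemblyRealiseMult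
open Summit.QuantumFields.BalabanUV.T4Continuum.HistoryZones Summit.QuantumFields.BalabanUV.T4Continuum.HistoryRealiseCells
open Summit.QuantumFields.BalabanUV.T4Continuum.HistoryRealiseCellsRun Summit.QuantumFields.BalabanUV.T4Continuum.HistoryAssemblyRealiseRunMult
open Summit.QuantumFields.BalabanUV.T4Continuum.HistoryRealiseCellsRunMult Summit.QuantumFields.BalabanUV.T4Continuum.HistoryAssemblyMultInstance
open Summit.QuantumFields.BalabanUV.T4Continuum.HistoryJoinsPlacedMember Summit.QuantumFields.BalabanUV.T4Continuum.PlacementSkeleton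
open Summit.QuantumFields.BalabanUV.T4Continuum.HistoryJoinsPlacedMult Summit.QuantumFields.BalabanUV.T4Continuum.HistoryRealiseDistinct
open Summit.QuantumFields.BalabanUV.T4Continuum.HistoryRegionTemplates Summit.QuantumFields.BalabanUV.T4Continuum.HistoryCaps
open Summit.QuantumFields.BalabanUV.T4Continuum.HistoryZoneEvolve (cth)
open Literature.MathematicalPhysics.QuantumFieldTheory.Balaban1983to89.B16SProfile (DropCtl)
open Summit.QuantumFields.BalabanUV.T4Continuum.HistoryRealiseCellsRunMultEnd Summit.QuantumFields.BalabanUV.T4Continuum.HistoryRealiseCellsRunMultEndD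
open Summit.QuantumFields.BalabanUV.T4Continuum.HistoryRealiseCellsRunPinnedT3b Summit.QuantumFields.BalabanUV.T4Continuum.HistoryHybridRescale
open Summit.QuantumFields.BalabanUV.T4Continuum.HistoryRealiseCellsRunApex (exists_const_schemeZ)
open Summit.QuantumFields.BalabanUV.T4Continuum.HistoryRealisePrint Summit.QuantumFields.BalabanUV.T4Continuum.HistoryRealiseWeak
open Summit.QuantumFields.BalabanUV.T4Continuum.HistoryRealisePrintReading Summit.QuantumFields.BalabanUV.T4Continuum.HistoryRealiseWeakReading
open Summit.QuantumFields.BalabanUV.T4Continuum.HistoryRealisePrintCells Summit.QuantumFields.BalabanUV.T4Continuum.HistoryRealiseWeakCells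
open Summit.QuantumFields.BalabanUV.T4Continuum.HistoryRealiseCellsRunApexT3b Summit.QuantumFields.BalabanUV.T4Continuum.HistoryRealiseCellsRunApexT3bW

open Summit.QuantumFields.BalabanUV.T4Continuum.HistoryRealiseCellsRunApexT3bWT Summit.QuantumFields.BalabanUV.T4Continuum.HistoryRealiseCellsRunPinnedT3bWT
open Summit.QuantumFields.BalabanUV.T4Continuum.HistoryRealiseCellsRunHeadlineT3bWT
open Summit.QuantumFields.BalabanUV.T4Continuum.HistoryRealiseCellsRunApexT3bWTV Summit.QuantumFields.BalabanUV.T4Continuum.HistoryBankingVolumePlug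
open Summit.QuantumFields.BalabanUV.T4Continuum.HistoryRealiseCellsRunApexT3bWTVS
open Summit.QuantumFields.BalabanUV.T4Continuum.HistoryGenealogyRealise
open Summit.QuantumFields.BalabanUV.T4Continuum.HistoryGenealogyInstantiate
open Summit.QuantumFields.BalabanUV.T4Continuum.B16HistoryIndexedRepr
open Summit.QuantumFields.BalabanUV.T4Continuum.HistoryBankingDiscountCharge
open Summit.QuantumFields.BalabanUV.T4Continuum.HistoryBankingCreditRead
open Summit.QuantumFields.BalabanUV.T4Continuum.HistoryBankingFibreRoom
open Summit.QuantumFields.BalabanUV.T4Continuum.HistoryPriceKeys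
open Summit.QuantumFields.BalabanUV.T4Continuum.HistoryRealiseCellsRunSupplyWTVS
open Summit.QuantumFields.BalabanUV.T4Continuum.HistoryRealiseCellsRunSupplyKeysWTVS
open Summit.QuantumFields.BalabanUV.T4Continuum.HistoryRealiseCellsRunAssemblyWTVSData
open Summit.QuantumFields.BalabanUV.T4Continuum.HistoryRealiseWeakCells
open Summit.QuantumFields.BalabanUV.T4Continuum.B16HistoryIndexedTrunc
open Summit.QuantumFields.BalabanUV.T4Continuum.HistoryRealiseCellsRunAssemblyWTVSDataL
open Summit.QuantumFields.BalabanUV.T4Continuum.HistoryRealiseCellsRunApexT3bWTVSL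
open Summit.QuantumFields.BalabanUV.T4Continuum.HistoryRealiseCellsRunHeadlineT3bPWTVSL

namespace Summit.QuantumFields.BalabanUV.T4Continuum.HistoryRealiseCellsRunAssemblyWTVSL

noncomputable section

set_option synthInstance.maxSize 1024

section Assembly

variable {F : T4Family} {G : Type*} [GaugeGroup G] [MeasurableSpace G] [HaarData G] [RegularGaugeGroup G]

omit [RegularGaugeGroup G] in
/-- **THE (α) ASSEMBLY, GUARDED — THE L-WITNESS INHABITED FROM M2 BRICK B's READING OF (1.72)** (R-OWNER-48-1 L5): from the
bundled inputs `HistReadDataL` (data + located displays, NOTHING of Bałaban's asserted; NO field known uninhabitable),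
`Nonempty (CountRoadWitnessT3bWTVSL D C O θᵥ rr d n hn g₀ os (HIndex.Idx I) (ℕ × Lab d) (Lab d))`.  FILE 2's term with the cut's
three plugs: the box input of `realised` from `hreg` (`inBoxOK_of_regionsInBox`), `disjointJoins := disjointJoinsL_pedV …`
(the guarded display PROVED on pass V), `boxedBirths := boxedBirths_pedV … hreg` transported along (c1); every other field has
its NAMED supplier exactly as in FILE 2 (crew + owner: `priceM_of_reading` ∕ `upM_of_reading'` ∕ `resumM_of_reading` ∕
`FM_nonneg_of_reading` ∕ `deadM_nonneg_of_reading` ∕ `nupOf_le`, M2-A `integral_eq_sum_weight`, M2-C `reprB_of_holds_trunc` ∕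
`upM'_of_trunc` ∕ `deadM'_nonneg_of_trunc` ∕ `resumM'_of_trunc`, JunctionV `realisedDomainsRW_of_familyV`). [folklore] -/
theorem nonempty_countRoadWitnessT3bWTVSL_of_histReadingL {D : FiniteEpsData F G} {C : T4PrintedShapeBanking.Consts}
    {O : PrintedO1s} {θv : ℝ} {rr d n : ℕ} {hn : 0 < n} {g₀ : ℕ → ℝ} {os : List (ULoop F)} {DomK : ℕ → Type}
    {I : (K : ℕ) → HIndex (DomK K)} [DecidableEq (HIndex.Idx I)] {DomK' : ℕ → Type} {I' : (K : ℕ) → HIndex (DomK' K)}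
    {X : ℕ → Type} [∀ K, MeasurableSpace (X K)] {μ : (K : ℕ) → Measure (X K)} [∀ K, IsFiniteMeasure (μ K)]
    {𝒢 : (K : ℕ) → GoodClass (X K)} {Y : ℕ → Type} [∀ K, MeasurableSpace (Y K)] {νB : (K : ℕ) → Measure (Y K)}
    [∀ K, IsFiniteMeasure (νB K)] {𝒢' : (K : ℕ) → GoodClass (Y K)}
    (Dd : HistReadDataL D C O θv rr d n hn g₀ os I I' X μ 𝒢 Y νB 𝒢') :
    Nonempty (CountRoadWitnessT3bWTVSL D C O θv rr d n hn g₀ os (HIndex.Idx I) (ℕ × Lab d) (Lab d)) := by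
  obtain ⟨l₀, vol, l₀_pos, vol_pos, K₀, RA, ρA, holdsA, intA, H2A, ℛ, hL, hs, Φf, hR, isRj, one_le_R, hL4, hprof, hdrop,
    hN, hRm, hRmS, hRm2, hD, hreg, hn₁, hE₂, hE₃, Lu, jl, hLu0, hj1, hLu, hsmall, huΦ, huE₂, huE₃, sB, sR, φB, φR, β', β₀,
    hF, hRR, h29, huV, W, one_le_W, Wi, BAi, mi, hWi, hBA, hmi, hρ, c₀, n₁, c₀_pos, floor, floor', sites, sites', RB, ρB,
    holdsB, intB, H2B, trunc, htr, dB, mup, sB', φB', sR', φR', hRR', upB, deadB_nonneg, resumB, mup_bd, shA, shB,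
    Wsh, shell, Cc, Rr, CcRec, RrRec, ν, u, s₂, q₀, r, s, budget, sum_r, sum_u, sum_s, sum_s₂⟩ := Dd
  -- the flow's letters at the reading
  have hL0 : 0 < F.L := lt_of_lt_of_le (by norm_num) (two_le_L F)
  have hL1 : 1 ≤ F.L := le_trans (by norm_num) (two_le_L F)
  have hL0' : 0 < ℛ.L := by rw [hL]; exact hL0
  have hL4' : 4 ≤ ℛ.L := by rw [hL]; exact hL4
  have hdrop' : ∀ K, K₀ ≤ K → ∀ m, DropCtl (ℛ.s K) m := by rw [hs]; exact hdrop
  have hWpos : ∀ K, 0 < W K := fun K => lt_of_lt_of_le one_pos (one_le_W K)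
  have hmass : ∀ K, 0 ≤ (μ K).real Set.univ := fun K => measureReal_nonneg
  -- PLUG 1 (the cut): the junction's box input READ OFF the input display `RegionsInBox`
  have hbox : ∀ K, K₀ ≤ K → ∀ τ ∈ HIndex.termSet I K, (ℛ.inputOf.run K τ).InBoxOK n K := fun K hK τ hτ =>
    RunInputM.inBoxOK_of_regionsInBox (hN K hK τ hτ) (hreg K hK τ hτ)
  -- (c3): `realised` first (JunctionV, transported along (c1)'s equations), then the root-cell injectivity
  have realised : RealisedDomainsRW F.L (runProfile F.L ℛ.R) n K₀ ℛ.R (HIndex.termSet I) ℛ.inputOf.pedV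
      (fun _ _ => id) ℛ.inputOf.liveCV ℛ.inputOf.ZV := by
    have h0 : RealisedDomainsRW ℛ.L ℛ.s n K₀ ℛ.R (HIndex.termSet I) ℛ.inputOf.pedV (fun _ _ => id) ℛ.inputOf.liveCV
        ℛ.inputOf.ZV :=
      ℛ.inputOf.realisedDomainsRW_of_familyV (HIndex.termSet I) n K₀ hN hRm hRmS hRm2 hD hL0' hbox
    rw [hL, hs] at h0
    exact h0
  have hinj : ∀ K, K₀ ≤ K → ∀ τ ∈ HIndex.termSet I K,
      Set.InjOn (cellOfR n F.L (runProfile F.L ℛ.R) ℛ.inputOf.pedV (fun _ _ => id) K τ)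
        (ℛ.inputOf.liveCV K τ : Set (ℕ × Lab d)) :=
    fun K hK τ hτ => cellOfR_injOn_W hL0 realised hK (hprof K hK) (hdrop K hK K) hτ
  -- PLUG 3 (the cut): `boxedBirths` PROVED of the reading from `hreg` (IR-47-1′ PART 3), transported along (c1) like `realised`
  have hBB : ∀ K, K₀ ≤ K → ∀ τ ∈ HIndex.termSet I K, ∀ c ∈ ℛ.inputOf.liveCV K τ,
      BoxedBirths n F.L K (levelOf (runProfile F.L ℛ.R K) K) ((ℛ.inputOf.pedV K τ).toPGen id c) := by
    have h0 : ∀ K, K₀ ≤ K → ∀ τ ∈ HIndex.termSet I K, ∀ c ∈ ℛ.inputOf.liveCV K τ,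
        BoxedBirths n ℛ.L K (levelOf (ℛ.s K) K) ((ℛ.inputOf.pedV K τ).toPGen id c) :=
      ℛ.inputOf.boxedBirths_pedV (HIndex.termSet I) n K₀ hN hRm hRmS hRm2 hD hL0' hreg
    rw [hL, hs] at h0
    exact h0
  refine ⟨{
    l₀ := l₀, vol := vol, l₀_pos := l₀_pos, vol_pos := vol_pos, K₀ := K₀, T := HIndex.termSet I,
    A := fun _ t => Repr172R.weight μ RA t, A' := weightB νB RB trunc, shA := shA, shB := shB,
    dead := fun K t τ => deadOf ℛ Φf W K t τ, dead' := aggW trunc (fun K => HIndex.termSet I' (K + 1)) dB,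
    nup := nupOf Φf (fun K => (μ K).real Set.univ) W, mup := mup, Nup := Real.exp BAi * mi * Wi,
    Cc := Cc, Rr := Rr, CcRec := CcRec, RrRec := RrRec, ν := ν, u := u, s₂ := s₂, q₀ := q₀, r := r, s := s, Wsh := Wsh,
    reprA := fun K t ht hK =>
      (H2A K t ht hK).trans (Repr172R.integral_eq_sum_weight μ RA K t (ρA K t) (holdsA K t) (intA K t)),
    reprB := fun K t ht hK =>
      (H2B K t ht hK).trans (reprB_of_holds_trunc νB RB trunc K (fun t => ∫ y, ρB K t y ∂νB (K + 1)) (ρB K)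
        (fun _ => rfl) (holdsB K) (intB K) (htr K hK) t),
    c₀ := c₀, n₁ := n₁, c₀_pos := c₀_pos, floor := floor, floor' := floor', sites := sites, sites' := sites',
    Nup_nonneg := mul_nonneg (mul_nonneg (Real.exp_pos _).le ((hmass 0).trans (hmi 0)))
      (zero_le_one.trans ((one_le_W 0).trans (hWi 0))),
    nup_bd := fun K t ht hK => ⟨nupOf_measure_nonneg Φf μ (fun K => (hWpos K).le) K t,
      nupOf_le Φf (hmass K) (hWpos K).le (hBA K t ht hK) (hmi K) (hWi K)⟩,
    mup_bd := mup_bd, R := ℛ.R, isRj := isRj, one_le_R := one_le_R,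
    ped := ℛ.inputOf.pedV, cellP := fun _ _ => id, liveC := ℛ.inputOf.liveCV, Zd := ℛ.inputOf.ZV,
    realised := realised,
    step_le := fun K _ τ _ c hc => by
      obtain ⟨x, -, rfl⟩ := Finset.mem_image.1 hc
      exact le_rfl,
    -- PLUG 2 (the cut): the GUARDED join display PROVED of the reading on pass V (IR-47-1′ PART 3); PLUG 3
    disjointJoins := ℛ.inputOf.disjointJoinsL_pedV (HIndex.termSet I) K₀ hN hRm hRmS hRm2 hD hL0',
    boxedBirths := hBB,
    FcM := fun K k => LIVEOf C K (ℛ.R K) (fun m => 2 ^ (d + 3) * Real.log (Φf.Λ K m)) (sharpT (sB K) (sR K)) k,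
    RfM := fun K k => MULTOf (sharpT (φB K) (φR K)) k,
    FcM' := fun K k => LIVEOf C K (ℛ.R K) (fun m => 2 ^ (d + 3) * Real.log (Φf.Λ K m)) (sharpT (sB' K) (sR' K)) k,
    RfM' := fun K k => MULTOf (sharpT (φB' K) (φR' K)) k,
    uV := fun K m => 2 ^ (d + 3) * Real.log (Φf.Λ K m), huV := huV,
    priceM := fun K t _ hK τ hτ =>
      priceM_of_reading ℛ Φf (hN K hK) (hRm K hK) (hRmS K hK) (hRm2 K hK) (hD K hK) hL0' hL4' (hdrop' K hK)
        (one_le_R K hK) hn₁ hE₂ hE₃ (hRR K hK) (h29 K hK) hL1 _ _ (hinj K hK) jhalf τ hτ,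
    priceM' := fun K t _ hK τ hτ =>
      priceM_of_reading ℛ Φf (hN K hK) (hRm K hK) (hRmS K hK) (hRm2 K hK) (hD K hK) hL0' hL4' (hdrop' K hK)
        (one_le_R K hK) hn₁ hE₂ hE₃ (hRR' K hK) (h29 K hK) hL1 _ _ (hinj K hK) jhalf τ hτ,
    upM := fun K t ht hK =>
      upM_of_reading' ℛ Φf μ RA hR hK ht (hN K hK) (hRm K hK) (hRmS K hK) (hRm2 K hK) (hD K hK) hL0' hL4'
        (hdrop' K hK) (one_le_R K hK) hn₁ hE₂.le hE₃ (hLu0 K hK) (hj1 K hK) (hLu K hK) (hsmall K hK) (huΦ K hK)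
        (huE₂ K hK) (huE₃ K hK) (hF K hK) (hWpos K) _ _ (hinj K hK) jhalf,
    deadM_nonneg := fun K t _ hK =>
      deadM_nonneg_of_reading ℛ Φf (hF K hK).fB_nonneg (hF K hK).fR_nonneg (hWpos K).le t _ _ jhalf,
    resumM := fun K t ht hK => resumM_of_reading ℛ Φf (hWpos K) t _ _ jhalf (φB K) (φR K) (hρ K t ht hK),
    FM_nonneg := fun K t _ _ => FM_nonneg_of_reading ℛ C K (ℛ.R K) _ _ _ _ jhalf,
    upM' := fun K t ht hK k hk =>
      upM'_of_trunc (fun K k => LIVEOf C K (ℛ.R K) (fun m => 2 ^ (d + 3) * Real.log (Φf.Λ K m))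
        (sharpT (sB' K) (sR' K)) k) mup (upB K t ht hK k hk),
    deadM'_nonneg := fun K t ht hK k hk => deadM'_nonneg_of_trunc (deadB_nonneg K t ht hK k hk),
    resumM' := fun K t ht hK k hk =>
      resumM'_of_trunc (fun K k => MULTOf (sharpT (φB' K) (φR' K)) k) (resumB K t ht hK k hk),
    FM'_nonneg := fun K t _ _ => FM_nonneg_of_reading ℛ C K (ℛ.R K) _ _ _ _ jhalf,
    shell := shell, budget := budget, sum_r := sum_r, sum_u := sum_u, sum_s := sum_s, sum_s₂ := sum_s₂ }⟩

end Assembly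

/-! ## §2 The headline corollary: the GUARDED P-road headline (END v3.1) with `hData` supplied by SOME guarded reading -/

section SU

variable {F : T4Family} {N : ℕ} [NeZero N] {ℰ : LoopAverage (Matrix.specialUnitaryGroup (Fin N) ℂ)}

/-- **THE HEADLINE PREDICATE FROM A GUARDED READING OF (1.72), OVER THE REPAIRED END v3.1** (R-OWNER-48-1 L5's terminal
theorem; the statement leaf-04 staged as `_fscP`, SUBSUMED here): `T4ContinuumYM4Torus.ContinuumYM4Torus D` for (0.4)-block-
averaged data on `SU(N)` with a measurable small-loop average, GIVEN the two pins `(B)` and `BetaPertHyp` BY NAME, the datum's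
sign conventions, END v3.1's constants-only side conditions with the split slack `C.a + (θ + θᵥ) ≤ ½γ₀A₁²` and `0 < θ` (NO
demand `hθJ`; inhabited: `exists_consts_countRoadT3bPWTVS`, p281090 §4), and — for all small-coupling tuned runs and every
loop string — SOME guarded reading `HistReadDataL D C O θᵥ rr d n hn g₀ os I I′ X μ 𝒢 Y ν 𝒢′` of the two runs' (1.72)
expansions (skeletons, spaces, measures existentially; its displays are THE R∕S-LIST of (α), none known uninhabitable).
`HistoryRealiseCellsRunHeadlineT3bPWTVSL.continuumYM4Torus_of_countRoadT3bPWTVSL_fsc` ∘ `ForSmallCouplings.mono` ∘ §1;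
`DecidableEq` of the index type is the reading's.  CONDITIONAL on everything the record displays; NE7b NOT proved; count 0∕9.
[folklore] -/
theorem continuumYM4Torus_of_histReadingL_fsc (D : FiniteEpsData F (Matrix.specialUnitaryGroup (Fin N) ℂ))
    (hBA : D.IsBlockAveraged ℰ) (hE : ℰ.MeasurableE)
    (hB : B16.EndStatementBPrinted D.C) (hβ : BetaPertHyp D.βfun) (hsign : B16.SignConventions D.C)
    {C : T4PrintedShapeBanking.Consts} {O : PrintedO1s}
    {rr : ℕ} {β₀ : ℝ} (h : ThresholdOK C F.L rr β₀) (hμ : 0 < C.μ) (d n : ℕ)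
    (hκ₁ : (d : ℝ) * Real.log F.L + 2 * Real.log 2 ≤ C.κ₁) (hE₀ : Real.log (2 + birthMass C) ≤ C.E₀)
    (hA₀ : 1 ≤ C.A₀) (hβ₀ : 0 < β₀) (hLβ : (F.L : ℝ) * β₀ ≤ 1) (hn₁ : 13 ≤ C.n₁) (hn : 0 < n)
    {θ θv : ℝ} (hθ : 0 < θ) (hslack : C.a + (θ + θv) ≤ O.γ₀ * O.A₁ ^ 2 / 2)
    (hE₂ : 0 < C.E₂) (hE₃ : 0 ≤ C.E₃) {sS : ℕ} (hsS : 1 ≤ sS)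
    (hsmall : (((2 * cth 32 1 sS + 1) ^ d : ℕ) : ℝ) * (5 : ℝ) ^ d * ((max 1 (2 * 32 + 2) : ℕ) : ℝ) ≤
      (F.L : ℝ) ^ (sS / 2) / 2)
    {θc : ℝ} (hθc0 : 0 ≤ θc) (hθc1 : θc < 1) (hθcs : 1 / 2 ≤ θc ^ sS)
    (hRead : T4ContinuumYM4Torus.ForSmallCouplings D fun g₀ => ∀ os : List (ULoop F),
        ∃ (DomK : ℕ → Type) (I : (K : ℕ) → HIndex (DomK K)) (_ : DecidableEq (HIndex.Idx I)) (DomK' : ℕ → Type)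
          (I' : (K : ℕ) → HIndex (DomK' K)) (X : ℕ → Type) (_ : ∀ K, MeasurableSpace (X K))
          (μ : (K : ℕ) → Measure (X K)) (_ : ∀ K, IsFiniteMeasure (μ K)) (𝒢 : (K : ℕ) → GoodClass (X K))
          (Y : ℕ → Type) (_ : ∀ K, MeasurableSpace (Y K)) (νB : (K : ℕ) → Measure (Y K))
          (_ : ∀ K, IsFiniteMeasure (νB K)) (𝒢' : (K : ℕ) → GoodClass (Y K)),
          Nonempty (HistReadDataL D C O θv rr d n hn g₀ os I I' X μ 𝒢 Y νB 𝒢')) :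
    T4ContinuumYM4Torus.ContinuumYM4Torus D :=
  continuumYM4Torus_of_countRoadT3bPWTVSL_fsc D hBA hE hB hβ hsign h hμ d n hκ₁ hE₀ hA₀ hβ₀ hLβ hn₁ hn hθ hslack hE₂ hE₃
    hsS hsmall hθc0 hθc1 hθcs
    (hRead.mono fun g₀ hg os => by
      obtain ⟨DomK, I, iI, DomK', I', X, mX, μ, hμf, 𝒢, Y, mY, νB, hνf, 𝒢', ⟨Dd⟩⟩ := hg os
      exact ⟨HIndex.Idx I, ℕ × Lab d, Lab d, iI, inferInstance, inferInstance,
        nonempty_countRoadWitnessT3bWTVSL_of_histReadingL Dd⟩)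


end SU

/-! ## §3 The record embedding modulo `hreg`: every `HistReadData` whose reading boxes its regions is a `HistReadDataL` -/

section Embed

variable {F : T4Family} {G : Type*} [GaugeGroup G] [MeasurableSpace G] [HaarData G] [RegularGaugeGroup G]

omit [RegularGaugeGroup G] in
/-- **THE RECORD EMBEDDING MODULO THE INPUT DISPLAY** (builder's addition, the record-level twin of the owner's
`CountRoadWitnessT3bWTVS.toL`): a FILE-1 record `HistReadData …` together with the per-term input display `RegionsInBox n K`
IS a guarded record — every field copied, `hDJ`∕`hBB` dropped (no longer fields), `hbox` dropped in favour of `hreg` (which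
implies it).  So any inhabitant of FILE 1's record on a reading that boxes its regions (e.g. a no-region toy reading, where
both displays are vacuous) inhabits L4's record, and §1 maps it to an L-witness.  Declared INTO FILE 1's namespace so that
`X.toL hreg` resolves by dot notation. [folklore] -/
def _root_.Summit.QuantumFields.BalabanUV.T4Continuum.HistoryRealiseCellsRunAssemblyWTVSData.HistReadData.toL
    {D : FiniteEpsData F G} {C : T4PrintedShapeBanking.Consts} {O : PrintedO1s} {θv : ℝ} {rr d n : ℕ} {hn : 0 < n}
    {g₀ : ℕ → ℝ} {os : List (ULoop F)} {DomK : ℕ → Type} {I : (K : ℕ) → HIndex (DomK K)} [DecidableEq (HIndex.Idx I)]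
    {DomK' : ℕ → Type} {I' : (K : ℕ) → HIndex (DomK' K)} {Xs : ℕ → Type} [∀ K, MeasurableSpace (Xs K)]
    {μ : (K : ℕ) → Measure (Xs K)} [∀ K, IsFiniteMeasure (μ K)] {𝒢 : (K : ℕ) → GoodClass (Xs K)} {Y : ℕ → Type}
    [∀ K, MeasurableSpace (Y K)] {νB : (K : ℕ) → Measure (Y K)} [∀ K, IsFiniteMeasure (νB K)] {𝒢' : (K : ℕ) → GoodClass (Y K)}
    (X : HistReadData D C O θv rr d n hn g₀ os I I' Xs μ 𝒢 Y νB 𝒢')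
    (hreg : ∀ K, X.K₀ ≤ K → ∀ τ ∈ HIndex.termSet I K, (X.ℛ.inputOf.run K τ).RegionsInBox n K) :
    HistReadDataL D C O θv rr d n hn g₀ os I I' Xs μ 𝒢 Y νB 𝒢' :=
  { l₀ := X.l₀, vol := X.vol, l₀_pos := X.l₀_pos, vol_pos := X.vol_pos, K₀ := X.K₀, RA := X.RA, ρA := X.ρA,
    holdsA := X.holdsA, intA := X.intA, H2A := X.H2A, ℛ := X.ℛ, hL := X.hL, hs := X.hs, Φf := X.Φf, hR := X.hR,
    isRj := X.isRj, one_le_R := X.one_le_R, hL4 := X.hL4, hprof := X.hprof, hdrop := X.hdrop, hN := X.hN,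
    hRm := X.hRm, hRmS := X.hRmS, hRm2 := X.hRm2, hD := X.hD, hreg := hreg, hn₁ := X.hn₁, hE₂ := X.hE₂, hE₃ := X.hE₃,
    Lu := X.Lu, jl := X.jl, hLu0 := X.hLu0, hj1 := X.hj1, hLu := X.hLu, hsmall := X.hsmall, huΦ := X.huΦ,
    huE₂ := X.huE₂, huE₃ := X.huE₃, sB := X.sB, sR := X.sR, φB := X.φB, φR := X.φR, β' := X.β', β₀ := X.β₀,
    hF := X.hF, hRR := X.hRR, h29 := X.h29, huV := X.huV, W := X.W, one_le_W := X.one_le_W, Wi := X.Wi, BAi := X.BAi,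
    mi := X.mi, hWi := X.hWi, hBA := X.hBA, hmi := X.hmi, hρ := X.hρ, c₀ := X.c₀, n₁ := X.n₁, c₀_pos := X.c₀_pos,
    floor := X.floor, floor' := X.floor', sites := X.sites, sites' := X.sites', RB := X.RB, ρB := X.ρB,
    holdsB := X.holdsB, intB := X.intB, H2B := X.H2B, trunc := X.trunc, htr := X.htr, dB := X.dB, mup := X.mup,
    sB' := X.sB', φB' := X.φB', sR' := X.sR', φR' := X.φR', hRR' := X.hRR', upB := X.upB,
    deadB_nonneg := X.deadB_nonneg, resumB := X.resumB, mup_bd := X.mup_bd, shA := X.shA, shB := X.shB, Wsh := X.Wsh,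
    shell := X.shell, Cc := X.Cc, Rr := X.Rr, CcRec := X.CcRec, RrRec := X.RrRec, ν := X.ν, u := X.u, s₂ := X.s₂,
    q₀ := X.q₀, r := X.r, s := X.s, budget := X.budget, sum_r := X.sum_r, sum_u := X.sum_u, sum_s := X.sum_s,
    sum_s₂ := X.sum_s₂ }

omit [RegularGaugeGroup G] in
/-- the embedding keeps the reading, the threshold and the factor data (so §1's carriers and suppliers are unchanged) [folklore] -/
theorem _root_.Summit.QuantumFields.BalabanUV.T4Continuum.HistoryRealiseCellsRunAssemblyWTVSData.HistReadData.toL_data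
    {D : FiniteEpsData F G} {C : T4PrintedShapeBanking.Consts} {O : PrintedO1s} {θv : ℝ} {rr d n : ℕ} {hn : 0 < n}
    {g₀ : ℕ → ℝ} {os : List (ULoop F)} {DomK : ℕ → Type} {I : (K : ℕ) → HIndex (DomK K)} [DecidableEq (HIndex.Idx I)]
    {DomK' : ℕ → Type} {I' : (K : ℕ) → HIndex (DomK' K)} {Xs : ℕ → Type} [∀ K, MeasurableSpace (Xs K)]
    {μ : (K : ℕ) → Measure (Xs K)} [∀ K, IsFiniteMeasure (μ K)] {𝒢 : (K : ℕ) → GoodClass (Xs K)} {Y : ℕ → Type}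
    [∀ K, MeasurableSpace (Y K)] {νB : (K : ℕ) → Measure (Y K)} [∀ K, IsFiniteMeasure (νB K)] {𝒢' : (K : ℕ) → GoodClass (Y K)}
    (X : HistReadData D C O θv rr d n hn g₀ os I I' Xs μ 𝒢 Y νB 𝒢')
    (hreg : ∀ K, X.K₀ ≤ K → ∀ τ ∈ HIndex.termSet I K, (X.ℛ.inputOf.run K τ).RegionsInBox n K) :
    (X.toL hreg).ℛ = X.ℛ ∧ (X.toL hreg).K₀ = X.K₀ ∧ (X.toL hreg).Φf = X.Φf ∧ (X.toL hreg).l₀ = X.l₀ ∧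
      (X.toL hreg).trunc = X.trunc :=
  ⟨rfl, rfl, rfl, rfl, rfl⟩

omit [RegularGaugeGroup G] in
/-- hence a FILE-1 record on a region-boxing reading already yields an L-witness (§1 ∘ `toL`) [folklore] -/
theorem nonempty_countRoadWitnessT3bWTVSL_of_histReading
    {D : FiniteEpsData F G} {C : T4PrintedShapeBanking.Consts} {O : PrintedO1s} {θv : ℝ} {rr d n : ℕ} {hn : 0 < n}
    {g₀ : ℕ → ℝ} {os : List (ULoop F)} {DomK : ℕ → Type} {I : (K : ℕ) → HIndex (DomK K)} [DecidableEq (HIndex.Idx I)]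
    {DomK' : ℕ → Type} {I' : (K : ℕ) → HIndex (DomK' K)} {Xs : ℕ → Type} [∀ K, MeasurableSpace (Xs K)]
    {μ : (K : ℕ) → Measure (Xs K)} [∀ K, IsFiniteMeasure (μ K)] {𝒢 : (K : ℕ) → GoodClass (Xs K)} {Y : ℕ → Type}
    [∀ K, MeasurableSpace (Y K)] {νB : (K : ℕ) → Measure (Y K)} [∀ K, IsFiniteMeasure (νB K)] {𝒢' : (K : ℕ) → GoodClass (Y K)}
    (X : HistReadData D C O θv rr d n hn g₀ os I I' Xs μ 𝒢 Y νB 𝒢')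
    (hreg : ∀ K, X.K₀ ≤ K → ∀ τ ∈ HIndex.termSet I K, (X.ℛ.inputOf.run K τ).RegionsInBox n K) :
    Nonempty (CountRoadWitnessT3bWTVSL D C O θv rr d n hn g₀ os (HIndex.Idx I) (ℕ × Lab d) (Lab d)) :=
  nonempty_countRoadWitnessT3bWTVSL_of_histReadingL (X.toL hreg)

end Embed

end

end Summit.QuantumFields.BalabanUV.T4Continuum.HistoryRealiseCellsRunAssemblyWTVSL
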